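import Summits.QuantumFields.YangMills.Theorems.BalabanUVNodesPortS1G3CWalkGeom
import Summits.QuantumFields.YangMills.Theorems.BalabanUVNodesPortS1G3CNearStep

/-!
# NODE O port PT-A — `stub_G3C` (repaired edition `G3CAtRecordL`), layer (α″): THE STEP BOUNDS RE-KEYED AT ONE PAIR — weighted Schur sums of `T^{(Z)}(φ)`, the lattice Combes–Thomas
# decay of `G_Z(x, φ)`, `‖T_Y(φ)‖`, the FAR and NEAR step bounds `‖S_{□,Y}(x, φ)‖` — from the lattice-Schur rows∕columns of the pieces `T_Y(φ)`, `Y ⊆ Z`, and the coercivity of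
# `T^{(Z)}(φ)|_Z` AT THE PAIR `φ` (no record-space membership), so that they run on an open neighbourhood of the record space

Cell `ym-nodeO-ideate`, porter hand `hand-27930-G3C` (g1); `--supports stmt-QuantumFields-27930`; count-neutral.  [16] = [Balaban1985UV3], [B9] = [Balaban1985BackgroundPropagators],
[I] = [Balaban1987RG1], [II] = [Balaban1988RG2Cluster].

WHY.  The g0 bricks ✓`weightedRowSum_g3cLocOp_le`, ✓`norm_g3cLocInv_apply_le_exp`, ✓`l2_opNorm_nonB0Block_TY_le`, ✓`l2_opNorm_g3cStep_le_far`, ✓`l2_opNorm_W_le`,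
✓`l2_opNorm_g3cStep_le_near` read (P4-lat)∕(P5ᶜ) through `hφ : encodeCfg φ ∈ recordUc … Z`; rows (g2)(g3)(g5) of `G3CPiecesAt` need them on an OPEN set, where only the POINT
hypotheses survive (with degraded constants).  This file re-proves them from the point hypotheses — the SAME proofs, the membership replaced by the two things it was used for:
`hlat : ∀ Y ⊆ Z, (weighted rows) ∧ (weighted columns)` at `φ` and `hco : T^{(Z)}(φ)|_Z` `Re`-coercive with `γ`.

WHAT THIS FILE PROVES (sorry-free): `weightedRowSum_g3cLocOp_le_of_lat` ∕ `weightedColSum_g3cLocOp_le_of_lat` (+ `_sub` versions on the indices of `Z`), ★`norm_g3cLocInv_apply_le_exp_of_pt`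
(`‖G_Z(x,φ) i j‖ ≤ e^{−κ·tdist(i,j)}/(γ/2)`, x-uniform), `l2_opNorm_nonB0Block_le_of_lat`, ★`l2_opNorm_g3cStep_le_far_of_pt`, `norm_W_apply_le_of_decay`, `l2_opNorm_W_le_of_decay`,
★`l2_opNorm_g3cStep_le_near_of_pt`.

HONEST FRAMING.  Elementary letters under point hypotheses (asserted for nothing); nothing of Bałaban asserted, ported or discharged; `stub_G3C` NOT closed; 27930 OPEN; NODE O 0∕1;
COUNT 8∕28 · K 1∕4 UNMOVED; finite `𝕋⁴_{L^K}` at fixed ε — NOT continuum ∕ OS ∕ Clay; **the Yang–Mills mass gap is NOT proved by any of this.**  No `sorry`, no `instance`, no `notation`;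
standard axioms.
-/

noncomputable section

open scoped BigOperators Matrix.Norms.L2Operator Topology Matrix Classical
open Filter Finset

namespace Summit.QuantumFields.YangMills.Theorems.BalabanUVNodesPortS1

open Summit.QuantumFields.YangMills.Theorems.K0RecordFormatNames
open Literature.MathematicalPhysics.QuantumFieldTheory.Balaban1983to89
open Literature.MathematicalPhysics.QuantumFieldTheory.Balaban1983to89.Node00
open Literature.MathematicalPhysics.QuantumFieldTheory.Balaban1983to89.T4Continuum (T4Family)
open Literature.MathematicalPhysics.QuantumFieldTheory.Balaban1983to89.TreeLengthTorus (TPt)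
open Literature.MathematicalPhysics.QuantumFieldTheory.Balaban1983to89.TreeLengthTorusTransfer (tblock tcollar card_tblock_le card_tcollar_le)
open Literature.MathematicalPhysics.QuantumFieldTheory.Balaban1983to89.B12TreeDecay (K₀ kappa₀)
open Literature.MathematicalPhysics.QuantumFieldTheory.Balaban1983to89.B3Taylor310LocalRemainder (tdist_self tdist_comm tdist_triangle)
open Literature.MathematicalPhysics.QuantumFieldTheory.Balaban1983to89.B5Prop11Lower (nsq nsq_nonneg)

section Steps

variable {F : T4Family}
variable {a₀ δ₀ c₀ γ₀ γ₁ δ₁ : ℝ} {Mc : ℕ} {α₀ α₁ ε₂₉ : ℝ} {k : ℕ}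
variable {TC : (n : ℕ) → Sect2.CPair (F.P (recordK₀ F Mc k + n)) (MatA 2) → FluctIdx F k (recordK₀ F Mc k + n) → FluctIdx F k (recordK₀ F Mc k + n) → ℂ}
variable {TY : (n : ℕ) → (recordDomSys F Mc k (recordK₀ F Mc k + n)).Dom → Sect2.CPair (F.P (recordK₀ F Mc k + n)) (MatA 2) →
  FluctIdx F k (recordK₀ F Mc k + n) → FluctIdx F k (recordK₀ F Mc k + n) → ℂ}
variable {TZY : Finset (Fin 4 → ℤ) → IntBondCfg → ((Fin 4 → ℤ) × Fin 4) × Fin 3 → ((Fin 4 → ℤ) × Fin 4) × Fin 3 → ℂ}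
variable {AdM : (n : ℕ) → (Site (F.P (recordK₀ F Mc k + n)) 0 → (MatA 2)ˣ) →
  Matrix (FluctIdx F k (recordK₀ F Mc k + n)) (FluctIdx F k (recordK₀ F Mc k + n)) ℂ}
variable {AdZ : ((Fin 4 → ℤ) → (MatA 2)ˣ) → (Fin 4 → ℤ) × Fin 4 → Matrix (Fin 3) (Fin 3) ℂ}

/-! ### Weighted Schur sums of `T^{(Z)}(φ)` from the lattice rows∕columns of the pieces at the pair -/

/-- ★ **WEIGHTED SCHUR ROW SUMS of `T^{(Z)}(φ)` from the point hypothesis**: if every piece `T_Y(φ)`, `Y ⊆ Z`, has weighted Schur rows `≤ c·e^{−δ₀ d_j(Y)}` with `δ₀ ≥ kappa₀(64,8)`, then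
`Σ_j ‖T^{(Z)}(φ) i j‖·e^{δ₁·tdist(i,j)} ≤ c·K₀(64, 8)`. [cite: Balaban1988RG2Cluster, (1.26) p.8; Balaban1985BackgroundPropagators, (3.42) p.399] -/
theorem weightedRowSum_g3cLocOp_le_of_lat (hP : P0CarrierClauses F a₀ δ₀ c₀ γ₀ γ₁ Mc α₀ α₁ ε₂₉ k TC TY TZY AdM AdZ) (hMc : McGuard F Mc) {c δ₁' : ℝ} (hc : 0 ≤ c)
    (hδ₀ : kappa₀ (4 * 2 ^ 4) (2 * 4) ≤ δ₀) (n : ℕ) (Z : (recordDomSys F Mc k (recordK₀ F Mc k + n)).Dom) {φ : Sect2.CPair (F.P (recordK₀ F Mc k + n)) (MatA 2)}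
    (hlat : ∀ Y : (recordDomSys F Mc k (recordK₀ F Mc k + n)).Dom, Y.1 ⊆ Z.1 →
      (∀ i : FluctIdx F k (recordK₀ F Mc k + n), ∑ j, ‖TY n Y φ i j‖ * Real.exp (δ₁' * (Site.tdist i.1.src j.1.src : ℝ)) ≤
          c * Real.exp (-(δ₀ * (recordDomSys F Mc k (recordK₀ F Mc k + n)).dj Y))) ∧
      (∀ j : FluctIdx F k (recordK₀ F Mc k + n), ∑ i, ‖TY n Y φ i j‖ * Real.exp (δ₁' * (Site.tdist i.1.src j.1.src : ℝ)) ≤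
          c * Real.exp (-(δ₀ * (recordDomSys F Mc k (recordK₀ F Mc k + n)).dj Y))))
    (i : NonB0Idx F k (recordK₀ F Mc k + n)) :
    ∑ j : NonB0Idx F k (recordK₀ F Mc k + n), ‖g3cLocOp F Mc k (recordK₀ F Mc k + n) (TY n) Z φ i j‖ *
        Real.exp (δ₁' * (Site.tdist i.1.1.src j.1.1.src : ℝ)) ≤ c * K₀ (4 * 2 ^ 4) (2 * 4) := by
  obtain ⟨-, -, -, -, -, -, -, -, hSupp, -⟩ := hP
  have hK : recordK₀ F Mc k ≤ recordK₀ F Mc k + n := Nat.le_add_right _ _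
  rw [g3cLocOp_eq_sum_ite]
  refine G3CGeom.weightedRowSum_sum_pieces_le (d := (F.P (recordK₀ F Mc k + n)).d)
    (fun s : NonB0Idx F k (recordK₀ F Mc k + n) => cubeOfSite F Mc k (recordK₀ F Mc k + n) (blockOf s.1.1.src))
    (fun Y => if Y.1 ⊆ Z.1 then (Matrix.of fun i j : NonB0Idx F k (recordK₀ F Mc k + n) => TY n Y φ i.1 j.1) else 0)
    (fun Y s s' hs => ?_) (fun i j => Real.exp (δ₁' * (Site.tdist i.1.1.src j.1.1.src : ℝ))) (fun _ _ => (Real.exp_pos _).le) hc hδ₀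
    (fun Y s => ?_) Finset.univ i
  · split_ifs with hY
    · exact fluct_supp_of_cube hMc hK (hSupp n) Y φ s s' (Or.inl hs)
    · rfl
  · split_ifs with hY
    · refine le_trans ?_ ((hlat Y hY).1 s.1)
      simpa only [Matrix.of_apply] using
        sum_nonB0_le_sum_fluct k (recordK₀ F Mc k + n) (fun j => ‖TY n Y φ s.1 j‖ * Real.exp (δ₁' * (Site.tdist s.1.1.src j.1.src : ℝ)))
          (fun j => by positivity)
    · simp only [Matrix.zero_apply, norm_zero, zero_mul, Finset.sum_const_zero]
      positivity

/-- ★ **WEIGHTED SCHUR COLUMN SUMS of `T^{(Z)}(φ)` from the point hypothesis**. [cite: Balaban1988RG2Cluster, (1.26) p.8; Balaban1985BackgroundPropagators, (3.42) p.399] -/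
theorem weightedColSum_g3cLocOp_le_of_lat (hP : P0CarrierClauses F a₀ δ₀ c₀ γ₀ γ₁ Mc α₀ α₁ ε₂₉ k TC TY TZY AdM AdZ) (hMc : McGuard F Mc) {c δ₁' : ℝ} (hc : 0 ≤ c)
    (hδ₀ : kappa₀ (4 * 2 ^ 4) (2 * 4) ≤ δ₀) (n : ℕ) (Z : (recordDomSys F Mc k (recordK₀ F Mc k + n)).Dom) {φ : Sect2.CPair (F.P (recordK₀ F Mc k + n)) (MatA 2)}
    (hlat : ∀ Y : (recordDomSys F Mc k (recordK₀ F Mc k + n)).Dom, Y.1 ⊆ Z.1 →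
      (∀ i : FluctIdx F k (recordK₀ F Mc k + n), ∑ j, ‖TY n Y φ i j‖ * Real.exp (δ₁' * (Site.tdist i.1.src j.1.src : ℝ)) ≤
          c * Real.exp (-(δ₀ * (recordDomSys F Mc k (recordK₀ F Mc k + n)).dj Y))) ∧
      (∀ j : FluctIdx F k (recordK₀ F Mc k + n), ∑ i, ‖TY n Y φ i j‖ * Real.exp (δ₁' * (Site.tdist i.1.src j.1.src : ℝ)) ≤
          c * Real.exp (-(δ₀ * (recordDomSys F Mc k (recordK₀ F Mc k + n)).dj Y))))
    (j : NonB0Idx F k (recordK₀ F Mc k + n)) :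
    ∑ i : NonB0Idx F k (recordK₀ F Mc k + n), ‖g3cLocOp F Mc k (recordK₀ F Mc k + n) (TY n) Z φ i j‖ *
        Real.exp (δ₁' * (Site.tdist i.1.1.src j.1.1.src : ℝ)) ≤ c * K₀ (4 * 2 ^ 4) (2 * 4) := by
  obtain ⟨-, -, -, -, -, -, -, -, hSupp, -⟩ := hP
  have hK : recordK₀ F Mc k ≤ recordK₀ F Mc k + n := Nat.le_add_right _ _
  rw [g3cLocOp_eq_sum_ite]
  refine G3CGeom.weightedColSum_sum_pieces_le (d := (F.P (recordK₀ F Mc k + n)).d)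
    (fun s : NonB0Idx F k (recordK₀ F Mc k + n) => cubeOfSite F Mc k (recordK₀ F Mc k + n) (blockOf s.1.1.src))
    (fun Y => if Y.1 ⊆ Z.1 then (Matrix.of fun i j : NonB0Idx F k (recordK₀ F Mc k + n) => TY n Y φ i.1 j.1) else 0)
    (fun Y s s' hs' => ?_) (fun i j => Real.exp (δ₁' * (Site.tdist i.1.1.src j.1.1.src : ℝ))) (fun _ _ => (Real.exp_pos _).le) hc hδ₀
    (fun Y s' => ?_) Finset.univ j
  · split_ifs with hY
    · exact fluct_supp_of_cube hMc hK (hSupp n) Y φ s s' (Or.inr hs')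
    · rfl
  · split_ifs with hY
    · refine le_trans ?_ ((hlat Y hY).2 s'.1)
      simpa only [Matrix.of_apply] using
        sum_nonB0_le_sum_fluct k (recordK₀ F Mc k + n) (fun i => ‖TY n Y φ i s'.1‖ * Real.exp (δ₁' * (Site.tdist i.1.src s'.1.1.src : ℝ)))
          (fun i => by positivity)
    · simp only [Matrix.zero_apply, norm_zero, zero_mul, Finset.sum_const_zero]
      positivity

/-- Weighted Schur ROW sums of the restricted block `T^{(Z)}(φ)|_Z` from the point hypothesis. [folklore] -/
theorem weightedRowSum_g3cLocOp_sub_le_of_lat (hP : P0CarrierClauses F a₀ δ₀ c₀ γ₀ γ₁ Mc α₀ α₁ ε₂₉ k TC TY TZY AdM AdZ) (hMc : McGuard F Mc) {c δ₁' : ℝ} (hc : 0 ≤ c)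
    (hδ₀ : kappa₀ (4 * 2 ^ 4) (2 * 4) ≤ δ₀) (n : ℕ) (Z : (recordDomSys F Mc k (recordK₀ F Mc k + n)).Dom) {φ : Sect2.CPair (F.P (recordK₀ F Mc k + n)) (MatA 2)}
    (hlat : ∀ Y : (recordDomSys F Mc k (recordK₀ F Mc k + n)).Dom, Y.1 ⊆ Z.1 →
      (∀ i : FluctIdx F k (recordK₀ F Mc k + n), ∑ j, ‖TY n Y φ i j‖ * Real.exp (δ₁' * (Site.tdist i.1.src j.1.src : ℝ)) ≤
          c * Real.exp (-(δ₀ * (recordDomSys F Mc k (recordK₀ F Mc k + n)).dj Y))) ∧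
      (∀ j : FluctIdx F k (recordK₀ F Mc k + n), ∑ i, ‖TY n Y φ i j‖ * Real.exp (δ₁' * (Site.tdist i.1.src j.1.src : ℝ)) ≤
          c * Real.exp (-(δ₀ * (recordDomSys F Mc k (recordK₀ F Mc k + n)).dj Y))))
    (i : {i : NonB0Idx F k (recordK₀ F Mc k + n) // g3cInDom F Mc k (recordK₀ F Mc k + n) Z i}) :
    ∑ j : {i : NonB0Idx F k (recordK₀ F Mc k + n) // g3cInDom F Mc k (recordK₀ F Mc k + n) Z i},
      ‖(g3cLocOp F Mc k (recordK₀ F Mc k + n) (TY n) Z φ).submatrix Subtype.val Subtype.val i j‖ *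
        Real.exp (δ₁' * (Site.tdist i.1.1.1.src j.1.1.1.src : ℝ)) ≤ c * K₀ (4 * 2 ^ 4) (2 * 4) := by
  refine le_trans ?_ (weightedRowSum_g3cLocOp_le_of_lat hP hMc hc hδ₀ n Z hlat i.1)
  rw [← Fintype.sum_subtype_add_sum_subtype (fun j : NonB0Idx F k (recordK₀ F Mc k + n) => g3cInDom F Mc k (recordK₀ F Mc k + n) Z j)
    (fun j => ‖g3cLocOp F Mc k (recordK₀ F Mc k + n) (TY n) Z φ i.1 j‖ * Real.exp (δ₁' * (Site.tdist i.1.1.1.src j.1.1.src : ℝ)))]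
  exact le_add_of_nonneg_right (Finset.sum_nonneg fun j _ => by positivity)

/-- Weighted Schur COLUMN sums of the restricted block `T^{(Z)}(φ)|_Z` from the point hypothesis. [folklore] -/
theorem weightedColSum_g3cLocOp_sub_le_of_lat (hP : P0CarrierClauses F a₀ δ₀ c₀ γ₀ γ₁ Mc α₀ α₁ ε₂₉ k TC TY TZY AdM AdZ) (hMc : McGuard F Mc) {c δ₁' : ℝ} (hc : 0 ≤ c)
    (hδ₀ : kappa₀ (4 * 2 ^ 4) (2 * 4) ≤ δ₀) (n : ℕ) (Z : (recordDomSys F Mc k (recordK₀ F Mc k + n)).Dom) {φ : Sect2.CPair (F.P (recordK₀ F Mc k + n)) (MatA 2)}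
    (hlat : ∀ Y : (recordDomSys F Mc k (recordK₀ F Mc k + n)).Dom, Y.1 ⊆ Z.1 →
      (∀ i : FluctIdx F k (recordK₀ F Mc k + n), ∑ j, ‖TY n Y φ i j‖ * Real.exp (δ₁' * (Site.tdist i.1.src j.1.src : ℝ)) ≤
          c * Real.exp (-(δ₀ * (recordDomSys F Mc k (recordK₀ F Mc k + n)).dj Y))) ∧
      (∀ j : FluctIdx F k (recordK₀ F Mc k + n), ∑ i, ‖TY n Y φ i j‖ * Real.exp (δ₁' * (Site.tdist i.1.src j.1.src : ℝ)) ≤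
          c * Real.exp (-(δ₀ * (recordDomSys F Mc k (recordK₀ F Mc k + n)).dj Y))))
    (j : {i : NonB0Idx F k (recordK₀ F Mc k + n) // g3cInDom F Mc k (recordK₀ F Mc k + n) Z i}) :
    ∑ i : {i : NonB0Idx F k (recordK₀ F Mc k + n) // g3cInDom F Mc k (recordK₀ F Mc k + n) Z i},
      ‖(g3cLocOp F Mc k (recordK₀ F Mc k + n) (TY n) Z φ).submatrix Subtype.val Subtype.val i j‖ *
        Real.exp (δ₁' * (Site.tdist i.1.1.1.src j.1.1.1.src : ℝ)) ≤ c * K₀ (4 * 2 ^ 4) (2 * 4) := by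
  refine le_trans ?_ (weightedColSum_g3cLocOp_le_of_lat hP hMc hc hδ₀ n Z hlat j.1)
  rw [← Fintype.sum_subtype_add_sum_subtype (fun i : NonB0Idx F k (recordK₀ F Mc k + n) => g3cInDom F Mc k (recordK₀ F Mc k + n) Z i)
    (fun i => ‖g3cLocOp F Mc k (recordK₀ F Mc k + n) (TY n) Z φ i j.1‖ * Real.exp (δ₁' * (Site.tdist i.1.1.src j.1.1.1.src : ℝ)))]
  exact le_add_of_nonneg_right (Finset.sum_nonneg fun i _ => by positivity)

/-! ### The lattice Combes–Thomas decay of `G_Z(x, φ)` at the pair -/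

/-- ★★ **LATTICE-SCALE COMBES–THOMAS DECAY OF `G_Z(x, φ)` FROM THE POINT HYPOTHESES, x-UNIFORM**: lattice rows∕columns of the pieces `T_Y(φ)`, `Y ⊆ Z` (constant `c ≥ 0`, `δ₀ ≥ kappa₀(64,8)`),
coercivity of `T^{(Z)}(φ)|_Z` with `γ > 0`, and a rate `κ ≥ 0` with `2κ ≤ δ₁`, `4κ·(c·K₀(64,8)) ≤ γ·δ₁` give `‖G_Z(x, φ) i j‖ ≤ e^{−κ·tdist(i,j)}/(γ/2)` for every `x ≥ 0`.
[cite: Balaban1985BackgroundPropagators, (3.42) p.399; Balaban1985UV3, p.272 (after (63)); Balaban1987RG1, (1.18) p.263] -/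
theorem norm_g3cLocInv_apply_le_exp_of_pt (hP : P0CarrierClauses F a₀ δ₀ c₀ γ₀ γ₁ Mc α₀ α₁ ε₂₉ k TC TY TZY AdM AdZ) (hMc : McGuard F Mc) {c γ δ₁' : ℝ} (hc : 0 ≤ c)
    (hγ : 0 < γ) (hδ₁ : 0 < δ₁') (hδ₀ : kappa₀ (4 * 2 ^ 4) (2 * 4) ≤ δ₀) {κ : ℝ} (hκ : 0 ≤ κ) (hκδ : 2 * κ ≤ δ₁') (hκc : 4 * κ * (c * K₀ (4 * 2 ^ 4) (2 * 4)) ≤ γ * δ₁')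
    (n : ℕ) (Z : (recordDomSys F Mc k (recordK₀ F Mc k + n)).Dom) {φ : Sect2.CPair (F.P (recordK₀ F Mc k + n)) (MatA 2)}
    (hlat : ∀ Y : (recordDomSys F Mc k (recordK₀ F Mc k + n)).Dom, Y.1 ⊆ Z.1 →
      (∀ i : FluctIdx F k (recordK₀ F Mc k + n), ∑ j, ‖TY n Y φ i j‖ * Real.exp (δ₁' * (Site.tdist i.1.src j.1.src : ℝ)) ≤
          c * Real.exp (-(δ₀ * (recordDomSys F Mc k (recordK₀ F Mc k + n)).dj Y))) ∧
      (∀ j : FluctIdx F k (recordK₀ F Mc k + n), ∑ i, ‖TY n Y φ i j‖ * Real.exp (δ₁' * (Site.tdist i.1.src j.1.src : ℝ)) ≤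
          c * Real.exp (-(δ₀ * (recordDomSys F Mc k (recordK₀ F Mc k + n)).dj Y))))
    (hco : ∀ z : {i : NonB0Idx F k (recordK₀ F Mc k + n) // g3cInDom F Mc k (recordK₀ F Mc k + n) Z i} → ℂ,
      γ * nsq z ≤ (star z ⬝ᵥ ((g3cLocOp F Mc k (recordK₀ F Mc k + n) (TY n) Z φ).submatrix
        (Subtype.val : {i : NonB0Idx F k (recordK₀ F Mc k + n) // g3cInDom F Mc k (recordK₀ F Mc k + n) Z i} → _) Subtype.val *ᵥ z)).re)
    {x : ℝ} (hx : 0 ≤ x) (i j : NonB0Idx F k (recordK₀ F Mc k + n)) :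
    ‖g3cLocInv F Mc k (recordK₀ F Mc k + n) (TY n) Z x φ i j‖ ≤ Real.exp (-(κ * (Site.tdist i.1.1.src j.1.1.src : ℝ))) / (γ / 2) := by
  by_cases hi : g3cInDom F Mc k (recordK₀ F Mc k + n) Z i
  · by_cases hj : g3cInDom F Mc k (recordK₀ F Mc k + n) Z j
    · rw [g3cLocInv_apply_of_mem Mc k _ (TY n) Z x φ hi hj, g3cLocBlock]
      exact G3CCT.norm_resolvent_apply_le_of_weightedSchur _
        (fun a b : {i : NonB0Idx F k (recordK₀ F Mc k + n) // g3cInDom F Mc k (recordK₀ F Mc k + n) Z i} => (Site.tdist a.1.1.1.src b.1.1.1.src : ℝ))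
        (fun a => by exact_mod_cast tdist_self _) (fun a b => by exact_mod_cast Nat.zero_le _)
        (fun a b => by exact_mod_cast tdist_comm _ _) (fun a b c => by exact_mod_cast tdist_triangle _ _ _)
        hγ hδ₁ hκ hκδ hκc hco
        (weightedRowSum_g3cLocOp_sub_le_of_lat hP hMc hc hδ₀ n Z hlat) (weightedColSum_g3cLocOp_sub_le_of_lat hP hMc hc hδ₀ n Z hlat) hx ⟨i, hi⟩ ⟨j, hj⟩
    · rw [g3cLocInv_apply_of_not_mem Mc k _ (TY n) Z x φ (Or.inr hj), norm_zero]; positivity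
  · rw [g3cLocInv_apply_of_not_mem Mc k _ (TY n) Z x φ (Or.inl hi), norm_zero]; positivity

/-! ### `‖T_Y(φ)‖`, the far step -/

/-- **`‖T_Y(φ)‖ ≤ c·e^{−δ₀d_j(Y)}`** on the non-`b₀` block from the lattice rows∕columns at the pair (weight `≥ 1` for `δ₁ ≥ 0`; Schur test). [cite: Balaban1987RG1, (1.18) p.263, (2.11) p.267] -/
theorem l2_opNorm_nonB0Block_le_of_lat {K : ℕ} (k : ℕ) (A : FluctIdx F k K → FluctIdx F k K → ℂ) {δ₁' b : ℝ} (hδ₁ : 0 ≤ δ₁') (hb : 0 ≤ b)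
    (hrow : ∀ i : FluctIdx F k K, ∑ j, ‖A i j‖ * Real.exp (δ₁' * (Site.tdist i.1.src j.1.src : ℝ)) ≤ b)
    (hcol : ∀ j : FluctIdx F k K, ∑ i, ‖A i j‖ * Real.exp (δ₁' * (Site.tdist i.1.src j.1.src : ℝ)) ≤ b) :
    ‖nonB0Block F k K A‖ ≤ b := by
  have hrow' : ∀ i : FluctIdx F k K, ∑ j, ‖A i j‖ ≤ b := fun i =>
    le_trans (Finset.sum_le_sum fun j _ => by
      simpa using mul_le_mul_of_nonneg_left (Real.one_le_exp (by positivity : 0 ≤ δ₁' * (Site.tdist i.1.src j.1.src : ℝ))) (norm_nonneg (A i j))) (hrow i)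
  have hcol' : ∀ j : FluctIdx F k K, ∑ i, ‖A i j‖ ≤ b := fun j =>
    le_trans (Finset.sum_le_sum fun i _ => by
      simpa using mul_le_mul_of_nonneg_left (Real.one_le_exp (by positivity : 0 ≤ δ₁' * (Site.tdist i.1.src j.1.src : ℝ))) (norm_nonneg (A i j))) (hcol j)
  refine l2_opNorm_le_of_row_col_sum _ hb (fun i => ?_) (fun j => ?_)
  · refine le_trans ?_ (hrow' i.1)
    simpa only [nonB0Block, Matrix.of_apply] using sum_nonB0_le_sum_fluct k K (fun j => ‖A i.1 j‖) (fun _ => norm_nonneg _)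
  · refine le_trans ?_ (hcol' j.1)
    simpa only [nonB0Block, Matrix.of_apply] using sum_nonB0_le_sum_fluct k K (fun i => ‖A i j.1‖) (fun _ => norm_nonneg _)

/-- ★ **THE FAR-STEP BOUND AT THE PAIR**: `‖S_{□,Y}(x, φ)‖ ≤ c·e^{−δ₀d_j(Y)}·γ⁻¹` from the lattice rows∕columns of `T_Y(φ)` and the coercivity of `T^{(□̃)}(φ)|_□̃`, `x ≥ 0`.
[cite: Balaban1985BackgroundPropagators, (3.89) p.409; Balaban1985UV3, (23) p.262] -/
theorem l2_opNorm_g3cStep_le_far_of_pt {c γ δ₁' : ℝ} (hc : 0 ≤ c) (hγ : 0 < γ) (hδ₁ : 0 ≤ δ₁') (n : ℕ)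
    (q : TPt (F.P (recordK₀ F Mc k + n)).d (Sect2.domCount (F.P (recordK₀ F Mc k + n)) Mc (k + 1))) (Y : (recordDomSys F Mc k (recordK₀ F Mc k + n)).Dom)
    {φ : Sect2.CPair (F.P (recordK₀ F Mc k + n)) (MatA 2)}
    (hrow : ∀ i : FluctIdx F k (recordK₀ F Mc k + n), ∑ j, ‖TY n Y φ i j‖ * Real.exp (δ₁' * (Site.tdist i.1.src j.1.src : ℝ)) ≤
      c * Real.exp (-(δ₀ * (recordDomSys F Mc k (recordK₀ F Mc k + n)).dj Y)))
    (hcol : ∀ j : FluctIdx F k (recordK₀ F Mc k + n), ∑ i, ‖TY n Y φ i j‖ * Real.exp (δ₁' * (Site.tdist i.1.src j.1.src : ℝ)) ≤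
      c * Real.exp (-(δ₀ * (recordDomSys F Mc k (recordK₀ F Mc k + n)).dj Y)))
    (hco : ∀ z : {i : NonB0Idx F k (recordK₀ F Mc k + n) // g3cInDom F Mc k (recordK₀ F Mc k + n) (g3cBlk F Mc k (recordK₀ F Mc k + n) q) i} → ℂ,
      γ * nsq z ≤ (star z ⬝ᵥ ((g3cLocOp F Mc k (recordK₀ F Mc k + n) (TY n) (g3cBlk F Mc k (recordK₀ F Mc k + n) q) φ).submatrix
        (Subtype.val : {i : NonB0Idx F k (recordK₀ F Mc k + n) // g3cInDom F Mc k (recordK₀ F Mc k + n) (g3cBlk F Mc k (recordK₀ F Mc k + n) q) i} → _)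
        Subtype.val *ᵥ z)).re)
    {x : ℝ} (hx : 0 ≤ x) :
    ‖g3cStep F Mc k (recordK₀ F Mc k + n) (TY n) q Y x φ‖ ≤ c * Real.exp (-(δ₀ * (recordDomSys F Mc k (recordK₀ F Mc k + n)).dj Y)) * (1 / γ) := by
  have h0 : 0 ≤ c * Real.exp (-(δ₀ * (recordDomSys F Mc k (recordK₀ F Mc k + n)).dj Y)) := by positivity
  have h1 := l2_opNorm_nonB0Block_le_of_lat (F := F) k (TY n Y φ) hδ₁ h0 hrow hcol
  have h2 := l2_opNorm_g3cProj_le (F := F) Mc k (recordK₀ F Mc k + n) (g3cBlk F Mc k (recordK₀ F Mc k + n) q)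
  have h3 : ‖g3cLocInv F Mc k (recordK₀ F Mc k + n) (TY n) (g3cBlk F Mc k (recordK₀ F Mc k + n) q) x φ‖ ≤ 1 / γ := by
    rw [g3cLocInv_eq_extend]
    refine (G3CInv.l2_opNorm_extend_le _).trans ?_
    rw [g3cLocBlock]
    exact G3CCT.l2_opNorm_resolvent_le_of_reCoercive hγ hco hx
  have h4 := l2_opNorm_g3cInd_le (F := F) Mc k (recordK₀ F Mc k + n) q
  rw [g3cStep]
  calc ‖nonB0Block F k (recordK₀ F Mc k + n) (TY n Y φ) * g3cProj F Mc k (recordK₀ F Mc k + n) (g3cBlk F Mc k (recordK₀ F Mc k + n) q) *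
        g3cLocInv F Mc k (recordK₀ F Mc k + n) (TY n) (g3cBlk F Mc k (recordK₀ F Mc k + n) q) x φ * g3cInd F Mc k (recordK₀ F Mc k + n) q‖
      ≤ ‖nonB0Block F k (recordK₀ F Mc k + n) (TY n Y φ) * g3cProj F Mc k (recordK₀ F Mc k + n) (g3cBlk F Mc k (recordK₀ F Mc k + n) q) *
          g3cLocInv F Mc k (recordK₀ F Mc k + n) (TY n) (g3cBlk F Mc k (recordK₀ F Mc k + n) q) x φ‖ * ‖g3cInd F Mc k (recordK₀ F Mc k + n) q‖ := norm_mul_le _ _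
    _ ≤ (‖nonB0Block F k (recordK₀ F Mc k + n) (TY n Y φ) * g3cProj F Mc k (recordK₀ F Mc k + n) (g3cBlk F Mc k (recordK₀ F Mc k + n) q)‖ *
          ‖g3cLocInv F Mc k (recordK₀ F Mc k + n) (TY n) (g3cBlk F Mc k (recordK₀ F Mc k + n) q) x φ‖) * 1 :=
        mul_le_mul (norm_mul_le _ _) h4 (norm_nonneg _) (by positivity)
    _ ≤ ((‖nonB0Block F k (recordK₀ F Mc k + n) (TY n Y φ)‖ * ‖g3cProj F Mc k (recordK₀ F Mc k + n) (g3cBlk F Mc k (recordK₀ F Mc k + n) q)‖) * (1 / γ)) * 1 := by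
        refine mul_le_mul_of_nonneg_right (mul_le_mul (norm_mul_le _ _) h3 (norm_nonneg _) (by positivity)) zero_le_one
    _ ≤ ((c * Real.exp (-(δ₀ * (recordDomSys F Mc k (recordK₀ F Mc k + n)).dj Y)) * 1) * (1 / γ)) * 1 := by
        refine mul_le_mul_of_nonneg_right (mul_le_mul_of_nonneg_right (mul_le_mul h1 h2 (norm_nonneg _) h0) (by positivity)) zero_le_one
    _ = c * Real.exp (-(δ₀ * (recordDomSys F Mc k (recordK₀ F Mc k + n)).dj Y)) * (1 / γ) := by ring

/-! ### The near step: `W := D_Y·P_□̃·G_□·𝟙_□` under a decay hypothesis on `G_□` -/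

/-- **Entries of `W`** for `Y` avoiding `tblock □` under a lattice decay `‖G_□(x,φ) l m‖ ≤ e^{−κ·tdist(l,m)}/(γ/2)`: `‖W l m‖ ≤ e^{−κ·L·Mc}/(γ/2)`.
[cite: Balaban1985BackgroundPropagators, (3.94) p.410, (3.42) p.399] -/
theorem norm_W_apply_le_of_decay (hMc : McGuard F Mc) {γ : ℝ} (hγ : 0 < γ) {κ : ℝ} (hκ : 0 ≤ κ) (n : ℕ)
    (q : TPt (F.P (recordK₀ F Mc k + n)).d (Sect2.domCount (F.P (recordK₀ F Mc k + n)) Mc (k + 1))) (Y : (recordDomSys F Mc k (recordK₀ F Mc k + n)).Dom)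
    (hY : ∀ c ∈ (Y.1 : Finset _), c ∉ tblock q) {φ : Sect2.CPair (F.P (recordK₀ F Mc k + n)) (MatA 2)} {x : ℝ}
    (hG : ∀ l m : NonB0Idx F k (recordK₀ F Mc k + n), ‖g3cLocInv F Mc k (recordK₀ F Mc k + n) (TY n) (g3cBlk F Mc k (recordK₀ F Mc k + n) q) x φ l m‖ ≤
      Real.exp (-(κ * (Site.tdist l.1.1.src m.1.1.src : ℝ))) / (γ / 2))
    (l m : NonB0Idx F k (recordK₀ F Mc k + n)) :
    ‖(Matrix.diagonal (fun s : NonB0Idx F k (recordK₀ F Mc k + n) =>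
          if cubeOfSite F Mc k (recordK₀ F Mc k + n) (blockOf s.1.1.src) ∈ (Y.1 : Finset _) then (1 : ℂ) else 0) *
        g3cProj F Mc k (recordK₀ F Mc k + n) (g3cBlk F Mc k (recordK₀ F Mc k + n) q) *
        g3cLocInv F Mc k (recordK₀ F Mc k + n) (TY n) (g3cBlk F Mc k (recordK₀ F Mc k + n) q) x φ * g3cInd F Mc k (recordK₀ F Mc k + n) q) l m‖ ≤ Real.exp (-(κ * ((F.L * Mc : ℕ) : ℝ))) / (γ / 2) := by
  have hK : recordK₀ F Mc k ≤ recordK₀ F Mc k + n := Nat.le_add_right _ _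
  have hB0 : 0 ≤ Real.exp (-(κ * ((F.L * Mc : ℕ) : ℝ))) / (γ / 2) := by positivity
  rw [W_apply]
  by_cases hl : cubeOfSite F Mc k (recordK₀ F Mc k + n) (blockOf l.1.1.src) ∈ (Y.1 : Finset _)
  · by_cases hm : cubeOfSite F Mc k (recordK₀ F Mc k + n) (blockOf m.1.1.src) = q
    · have hG' := hG l m
      have htd : F.L * Mc ≤ Site.tdist l.1.1.src m.1.1.src :=
        G3CGeom.mul_le_tdist_of_cube_not_mem_tblock hMc hK _ _ (by rw [hm]; exact hY _ hl)
      have hmono : Real.exp (-(κ * (Site.tdist l.1.1.src m.1.1.src : ℝ))) ≤ Real.exp (-(κ * ((F.L * Mc : ℕ) : ℝ))) := by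
        apply Real.exp_le_exp.2
        have : ((F.L * Mc : ℕ) : ℝ) ≤ (Site.tdist l.1.1.src m.1.1.src : ℝ) := by exact_mod_cast htd
        nlinarith
      have hfac1 : ‖(if cubeOfSite F Mc k (recordK₀ F Mc k + n) (blockOf l.1.1.src) ∈ (Y.1 : Finset _) then (1 : ℂ) else 0) *
          (if g3cInDom F Mc k (recordK₀ F Mc k + n) (g3cBlk F Mc k (recordK₀ F Mc k + n) q) l then (1 : ℂ) else 0)‖ ≤ 1 := by
        rw [norm_mul]
        have a1 : ‖(if cubeOfSite F Mc k (recordK₀ F Mc k + n) (blockOf l.1.1.src) ∈ (Y.1 : Finset _) then (1 : ℂ) else 0)‖ ≤ 1 := by rw [if_pos hl]; simp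
        have a2 : ‖(if g3cInDom F Mc k (recordK₀ F Mc k + n) (g3cBlk F Mc k (recordK₀ F Mc k + n) q) l then (1 : ℂ) else 0)‖ ≤ 1 := by split_ifs <;> simp
        exact mul_le_one₀ a1 (norm_nonneg _) a2
      have hfac3 : ‖(((if cubeOfSite F Mc k (recordK₀ F Mc k + n) (blockOf m.1.1.src) = q then (1 : ℝ) else 0 : ℝ)) : ℂ)‖ ≤ 1 := by
        rw [Complex.norm_real, if_pos hm]; simp
      calc ‖(if cubeOfSite F Mc k (recordK₀ F Mc k + n) (blockOf l.1.1.src) ∈ (Y.1 : Finset _) then (1 : ℂ) else 0) *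
              (if g3cInDom F Mc k (recordK₀ F Mc k + n) (g3cBlk F Mc k (recordK₀ F Mc k + n) q) l then (1 : ℂ) else 0) *
              g3cLocInv F Mc k (recordK₀ F Mc k + n) (TY n) (g3cBlk F Mc k (recordK₀ F Mc k + n) q) x φ l m *
              (((if cubeOfSite F Mc k (recordK₀ F Mc k + n) (blockOf m.1.1.src) = q then (1 : ℝ) else 0 : ℝ)) : ℂ)‖
          ≤ 1 * ‖g3cLocInv F Mc k (recordK₀ F Mc k + n) (TY n) (g3cBlk F Mc k (recordK₀ F Mc k + n) q) x φ l m‖ * 1 := by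
            rw [norm_mul, norm_mul]
            exact mul_le_mul (mul_le_mul_of_nonneg_right hfac1 (norm_nonneg _)) hfac3 (norm_nonneg _) (by positivity)
        _ ≤ Real.exp (-(κ * ((F.L * Mc : ℕ) : ℝ))) / (γ / 2) := by
            rw [one_mul, mul_one]; exact hG'.trans (div_le_div_of_nonneg_right hmono (by positivity))
    · rw [if_neg hm]; simpa using hB0
  · rw [if_neg hl]; simpa using hB0

/-- **`‖W‖ ≤ 3^8·(12(L·Mc)^4)·e^{−κ·L·Mc}/(γ/2)`** for `Y` avoiding `tblock □`, under the lattice decay of `G_□(x, φ)` (Schur test over the cube `□` and the block `□̃`).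
[cite: Balaban1985BackgroundPropagators, (3.94) p.410] -/
theorem l2_opNorm_W_le_of_decay (hMc : McGuard F Mc) {γ : ℝ} (hγ : 0 < γ) {κ : ℝ} (hκ : 0 ≤ κ) (n : ℕ)
    (q : TPt (F.P (recordK₀ F Mc k + n)).d (Sect2.domCount (F.P (recordK₀ F Mc k + n)) Mc (k + 1))) (Y : (recordDomSys F Mc k (recordK₀ F Mc k + n)).Dom)
    (hY : ∀ c ∈ (Y.1 : Finset _), c ∉ tblock q) {φ : Sect2.CPair (F.P (recordK₀ F Mc k + n)) (MatA 2)} {x : ℝ}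
    (hG : ∀ l m : NonB0Idx F k (recordK₀ F Mc k + n), ‖g3cLocInv F Mc k (recordK₀ F Mc k + n) (TY n) (g3cBlk F Mc k (recordK₀ F Mc k + n) q) x φ l m‖ ≤
      Real.exp (-(κ * (Site.tdist l.1.1.src m.1.1.src : ℝ))) / (γ / 2)) :
    ‖(Matrix.diagonal (fun s : NonB0Idx F k (recordK₀ F Mc k + n) =>
          if cubeOfSite F Mc k (recordK₀ F Mc k + n) (blockOf s.1.1.src) ∈ (Y.1 : Finset _) then (1 : ℂ) else 0) *
        g3cProj F Mc k (recordK₀ F Mc k + n) (g3cBlk F Mc k (recordK₀ F Mc k + n) q) *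
        g3cLocInv F Mc k (recordK₀ F Mc k + n) (TY n) (g3cBlk F Mc k (recordK₀ F Mc k + n) q) x φ * g3cInd F Mc k (recordK₀ F Mc k + n) q)‖ ≤
      (3 ^ 4 * 3 ^ 4 * (3 * 4 * (F.L * Mc) ^ 4) : ℕ) * (Real.exp (-(κ * ((F.L * Mc : ℕ) : ℝ))) / (γ / 2)) := by
  have hK : recordK₀ F Mc k ≤ recordK₀ F Mc k + n := Nat.le_add_right _ _
  set B : ℝ := Real.exp (-(κ * ((F.L * Mc : ℕ) : ℝ))) / (γ / 2) with hB
  have hB0 : 0 ≤ B := by positivity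
  set Nq : ℕ := 3 ^ 4 * 3 ^ 4 * (3 * 4 * (F.L * Mc) ^ 4) with hNq
  have hW := norm_W_apply_le_of_decay hMc hγ hκ n q Y hY hG
  have hrowcnt : ((univ.filter fun s : NonB0Idx F k (recordK₀ F Mc k + n) =>
      cubeOfSite F Mc k (recordK₀ F Mc k + n) (blockOf s.1.1.src) = q).card : ℝ) ≤ Nq := by
    have h : (univ.filter fun s : NonB0Idx F k (recordK₀ F Mc k + n) => cubeOfSite F Mc k (recordK₀ F Mc k + n) (blockOf s.1.1.src) = q).card ≤
        3 * 4 * (F.L * Mc) ^ 4 := card_filter_cube_le hMc hK q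
    have h' : 3 * 4 * (F.L * Mc) ^ 4 ≤ Nq := by rw [hNq]; exact Nat.le_mul_of_pos_left _ (by positivity)
    exact_mod_cast h.trans h'
  have hcolcnt : ((univ.filter fun s : NonB0Idx F k (recordK₀ F Mc k + n) =>
      g3cInDom F Mc k (recordK₀ F Mc k + n) (g3cBlk F Mc k (recordK₀ F Mc k + n) q) s).card : ℝ) ≤ Nq := by
    have h : (univ.filter fun s : NonB0Idx F k (recordK₀ F Mc k + n) => g3cInDom F Mc k (recordK₀ F Mc k + n) (g3cBlk F Mc k (recordK₀ F Mc k + n) q) s).card ≤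
        3 ^ 4 * 3 ^ 4 * (3 * 4 * (F.L * Mc) ^ 4) := card_filter_inDom_blk_le hMc hK q
    exact_mod_cast h
  refine l2_opNorm_le_of_row_col_sum _ (by positivity) (fun l => ?_) (fun m => ?_)
  · calc ∑ m, ‖(_ : Matrix _ _ ℂ) l m‖
        = ∑ m : NonB0Idx F k (recordK₀ F Mc k + n), (if cubeOfSite F Mc k (recordK₀ F Mc k + n) (blockOf m.1.1.src) = q then
            ‖(Matrix.diagonal (fun s : NonB0Idx F k (recordK₀ F Mc k + n) =>
          if cubeOfSite F Mc k (recordK₀ F Mc k + n) (blockOf s.1.1.src) ∈ (Y.1 : Finset _) then (1 : ℂ) else 0) *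
        g3cProj F Mc k (recordK₀ F Mc k + n) (g3cBlk F Mc k (recordK₀ F Mc k + n) q) *
        g3cLocInv F Mc k (recordK₀ F Mc k + n) (TY n) (g3cBlk F Mc k (recordK₀ F Mc k + n) q) x φ * g3cInd F Mc k (recordK₀ F Mc k + n) q) l m‖ else 0) := by
          refine Finset.sum_congr rfl fun m _ => ?_
          split_ifs with hm
          · rfl
          · rw [W_apply_eq_zero_of_cube_ne Mc k _ (TY n) q Y x φ hm, norm_zero]
      _ ≤ ∑ m : NonB0Idx F k (recordK₀ F Mc k + n), (if cubeOfSite F Mc k (recordK₀ F Mc k + n) (blockOf m.1.1.src) = q then B else 0) := by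
          refine Finset.sum_le_sum fun m _ => ?_
          split_ifs
          · exact hW l m
          · exact le_rfl
      _ = ((univ.filter fun s : NonB0Idx F k (recordK₀ F Mc k + n) => cubeOfSite F Mc k (recordK₀ F Mc k + n) (blockOf s.1.1.src) = q).card : ℝ) * B := by
          rw [← Finset.sum_filter, Finset.sum_const, nsmul_eq_mul]
      _ ≤ Nq * B := mul_le_mul_of_nonneg_right hrowcnt hB0
  · calc ∑ l, ‖(_ : Matrix _ _ ℂ) l m‖
        = ∑ l : NonB0Idx F k (recordK₀ F Mc k + n), (if g3cInDom F Mc k (recordK₀ F Mc k + n) (g3cBlk F Mc k (recordK₀ F Mc k + n) q) l then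
            ‖(Matrix.diagonal (fun s : NonB0Idx F k (recordK₀ F Mc k + n) =>
          if cubeOfSite F Mc k (recordK₀ F Mc k + n) (blockOf s.1.1.src) ∈ (Y.1 : Finset _) then (1 : ℂ) else 0) *
        g3cProj F Mc k (recordK₀ F Mc k + n) (g3cBlk F Mc k (recordK₀ F Mc k + n) q) *
        g3cLocInv F Mc k (recordK₀ F Mc k + n) (TY n) (g3cBlk F Mc k (recordK₀ F Mc k + n) q) x φ * g3cInd F Mc k (recordK₀ F Mc k + n) q) l m‖ else 0) := by
          refine Finset.sum_congr rfl fun l _ => ?_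
          split_ifs with hl
          · rfl
          · rw [W_apply_eq_zero_of_not_inDom Mc k _ (TY n) q Y x φ hl, norm_zero]
      _ ≤ ∑ l : NonB0Idx F k (recordK₀ F Mc k + n), (if g3cInDom F Mc k (recordK₀ F Mc k + n) (g3cBlk F Mc k (recordK₀ F Mc k + n) q) l then B else 0) := by
          refine Finset.sum_le_sum fun l _ => ?_
          split_ifs
          · exact hW l m
          · exact le_rfl
      _ = ((univ.filter fun s : NonB0Idx F k (recordK₀ F Mc k + n) => g3cInDom F Mc k (recordK₀ F Mc k + n) (g3cBlk F Mc k (recordK₀ F Mc k + n) q) s).card : ℝ) * B := by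
          rw [← Finset.sum_filter, Finset.sum_const, nsmul_eq_mul]
      _ ≤ Nq * B := mul_le_mul_of_nonneg_right hcolcnt hB0

/-- ★★ **THE NEAR-STEP BOUND AT THE PAIR**: for `Y` avoiding `tblock □`, `x ≥ 0`, under the lattice rows∕columns of `T_Y(φ)` (constant `c`) and a lattice decay of `G_□(x, φ)` (rate `κ`,
constant `γ`): `‖S_{□,Y}(x, φ)‖ ≤ c·e^{−δ₀d_j(Y)} · 3^8·(12(L·Mc)^4) · e^{−κ·L·Mc}/(γ/2)`. [cite: Balaban1985BackgroundPropagators, (3.94) p.410; Balaban1985UV3, (23) p.262] -/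
theorem l2_opNorm_g3cStep_le_near_of_pt (hP : P0CarrierClauses F a₀ δ₀ c₀ γ₀ γ₁ Mc α₀ α₁ ε₂₉ k TC TY TZY AdM AdZ) (hMc : McGuard F Mc) {c γ δ₁' : ℝ} (hc : 0 ≤ c)
    (hγ : 0 < γ) (hδ₁ : 0 ≤ δ₁') {κ : ℝ} (hκ : 0 ≤ κ) (n : ℕ)
    (q : TPt (F.P (recordK₀ F Mc k + n)).d (Sect2.domCount (F.P (recordK₀ F Mc k + n)) Mc (k + 1))) (Y : (recordDomSys F Mc k (recordK₀ F Mc k + n)).Dom)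
    (hY : ∀ c ∈ (Y.1 : Finset _), c ∉ tblock q) {φ : Sect2.CPair (F.P (recordK₀ F Mc k + n)) (MatA 2)}
    (hrow : ∀ i : FluctIdx F k (recordK₀ F Mc k + n), ∑ j, ‖TY n Y φ i j‖ * Real.exp (δ₁' * (Site.tdist i.1.src j.1.src : ℝ)) ≤
      c * Real.exp (-(δ₀ * (recordDomSys F Mc k (recordK₀ F Mc k + n)).dj Y)))
    (hcol : ∀ j : FluctIdx F k (recordK₀ F Mc k + n), ∑ i, ‖TY n Y φ i j‖ * Real.exp (δ₁' * (Site.tdist i.1.src j.1.src : ℝ)) ≤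
      c * Real.exp (-(δ₀ * (recordDomSys F Mc k (recordK₀ F Mc k + n)).dj Y)))
    {x : ℝ}
    (hG : ∀ l m : NonB0Idx F k (recordK₀ F Mc k + n), ‖g3cLocInv F Mc k (recordK₀ F Mc k + n) (TY n) (g3cBlk F Mc k (recordK₀ F Mc k + n) q) x φ l m‖ ≤
      Real.exp (-(κ * (Site.tdist l.1.1.src m.1.1.src : ℝ))) / (γ / 2)) :
    ‖g3cStep F Mc k (recordK₀ F Mc k + n) (TY n) q Y x φ‖ ≤
      c * Real.exp (-(δ₀ * (recordDomSys F Mc k (recordK₀ F Mc k + n)).dj Y)) *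
        ((3 ^ 4 * 3 ^ 4 * (3 * 4 * (F.L * Mc) ^ 4) : ℕ) * (Real.exp (-(κ * ((F.L * Mc : ℕ) : ℝ))) / (γ / 2))) := by
  have h0 : 0 ≤ c * Real.exp (-(δ₀ * (recordDomSys F Mc k (recordK₀ F Mc k + n)).dj Y)) := by positivity
  have hT := l2_opNorm_nonB0Block_le_of_lat (F := F) k (TY n Y φ) hδ₁ h0 hrow hcol
  have hW := l2_opNorm_W_le_of_decay hMc hγ hκ n q Y hY hG
  have hsupp := nonB0Block_mul_cubeProj hP hMc n Y φ
  rw [g3cStep, ← hsupp]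
  simp only [Matrix.mul_assoc] at hW ⊢
  exact (norm_mul_le _ _).trans (mul_le_mul hT hW (norm_nonneg _) (by positivity))

end Steps

end Summit.QuantumFields.YangMills.Theorems.BalabanUVNodesPortS1

end
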